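import Literature.Computability.QuantumComplexity.ForrelationMSubspaceDuality
import HarnessLib

/-!
# Coset-affine structure bounds the forrelation: `|Φ(f,g)| · |V| ≤ 2^{n/2}`

Topic `Literature/Computability/QuantumComplexity` (family `quantum-advantage`; written for the prover seat of
crux `SignedCubicForrelationInPrBPP`, route `QuantumAdvantage/CubicForrelation`, item stmt-QuantumAdvantage-13933,
line `polar-radical-seeds`, 2026-08-16). Theorems only; continues the `DerivativeWalsh` development of
`ForrelationDerivativeTables.lean` (`W`, `fsum`), `ForrelationSignTransport.lean` (Parseval `sum_W_sq`) and
`ForrelationMSubspaceDuality.lean` (`coset_sum_of_affine_on_cosets`).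

Let `V ≤ 𝔽₂ⁿ` be a linear subspace, given as a finset of bit vectors containing `0` and closed under `⊕`,
and let the Boolean function `g` be AFFINE on every coset of `V` (all second differences of `g` along `V`
vanish; in Carlet's terminology `g` is `V`-normal up to affine terms, and for a bent `g` with `|V|² = 2ⁿ`
this is an *M-subspace* [Carlet2020, Def. 28, Prop. 54]). Then:

* `W_mem_zmultiples_card_of_affine_on_cosets`: every unnormalised Walsh coefficient
  `W_g(x) = ∑_y (-1)^{g(y) + x·y}` is an INTEGER multiple of `|V|` — each coset `y₀ ⊕ V` contributes
  `|V|`, `-|V|` or `0` (`coset_sum_of_affine_on_cosets`: on the coset the summand is `±` a multiplicative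
  `±1`-character of `V`), and the cosets through the points of any `⊕V`-invariant finset are peeled off one
  at a time (`exists_int_sum_eq_mul_card_of_invariant`, strong induction on the finset — no transversal and
  no quotient group is needed);
* `abs_forrelation_mul_card_le_sqrt`: `|Φ(f,g)| · |V| ≤ √(2ⁿ)` for EVERY `f`. Indeed `|W_g(x)| ∈ {0} ∪ [|V|, ∞)`
  gives `|V| · |W_g(x)| ≤ W_g(x)²` pointwise, so by Parseval `|V| · ∑_x |W_g(x)| ≤ ∑_x W_g(x)² = 4ⁿ`, while
  `2ⁿ √(2ⁿ) · |Φ| = |S(f,g)| = |∑_x (-1)^{f x} W_g(x)| ≤ ∑_x |W_g(x)|` (no Cauchy–Schwarz needed);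
* `abs_forrelation_le_half_of_affine_on_cosets`: if moreover `n` is even and `|V|² > 2ⁿ` then
  `|Φ(f,g)| ≤ 1/2` — since `|V| · |V^⊥| = 2ⁿ` (`card_mul_card_perp`) the cardinality `|V|` is a power of two,
  hence `|V| ≥ 2^{n/2 + 1}`.

So a pair `(f,g)` whose `g` is affine on the cosets of a subspace that is TOO LARGE (`dim V > n/2`) is never a
yes-instance of the Aaronson–Ambainis promise `Φ ≥ 3/5` [AaronsonAmbainis2018, §1.1.1]: over-structured
functions are off-promise, which is what the line `polar-radical-seeds` needs to discard degenerate seeds.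

## Contents (all proved)
* `exists_int_sum_eq_mul_card_of_invariant` (peeling cosets off a `⊕V`-invariant finset),
  `W_mem_zmultiples_card_of_affine_on_cosets`, `card_mul_abs_W_le_sq`,
  `abs_forrelation_mul_card_le_sqrt`, `abs_forrelation_le_half_of_affine_on_cosets`.
Not here: `Submodule (ZMod 2)` language, bentness, anything computational.

## References
* [Carlet2020] C. Carlet, Boolean Functions for Cryptography and Coding Theory, CUP 2021: Def. 28 (normal /
  weakly normal functions), Prop. 54 (M-subspaces of Maiorana–McFarland bent functions), and the divisibility
  of Walsh values of functions affine on the cosets of a subspace (§6.1).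
* [AaronsonAmbainis2018] S. Aaronson, A. Ambainis, Forrelation, SIAM J. Comput. 47 (2018), §1.1.1 (`Φ`, the
  promise `Φ ≥ 3/5` vs `|Φ| ≤ 1/100`).
* [ODonnell2014] R. O'Donnell, Analysis of Boolean Functions (2014), §1.4 (Parseval), §3.3 (cosets).
-/

noncomputable section

namespace Literature.Computability.QuantumComplexity

namespace DerivativeWalsh

open Finset
open Literature.Computability.QuantumComplexity.BuzetChailloux
open Literature.Computability.QuantumComplexity.Simon (twist_mul_self twist_sq twist_eq_one_or sum_twist)

variable {n : ℕ}

/-! ### Peeling cosets: sums over `⊕V`-invariant finsets -/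

/-- **Coset peeling.** Let `V ∋ 0` be closed under `⊕` and let the finset `A` be invariant under `z ↦ z ⊕ u`
for all `u ∈ V` (a union of cosets of `V`). If for every `z ∈ A` the sum of `s` over the coset
`{y : z ⊕ y ∈ V}` of `z` is an integer multiple of `|V|`, then so is `∑_{z ∈ A} s z` (strong induction on `A`:
remove the coset of one point, which lies inside `A`, and recurse on the invariant remainder). [folklore] -/
theorem exists_int_sum_eq_mul_card_of_invariant {V : Finset (Fin n → Bool)} (h0 : zeroVec ∈ V)
    (hadd : ∀ x ∈ V, ∀ y ∈ V, bxor x y ∈ V) (s : (Fin n → Bool) → ℝ) (A : Finset (Fin n → Bool))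
    (hinv : ∀ z ∈ A, ∀ u ∈ V, bxor z u ∈ A)
    (hcos : ∀ z ∈ A, ∃ m : ℤ, ∑ y ∈ univ.filter (fun y => bxor z y ∈ V), s y = m * V.card) :
    ∃ k : ℤ, ∑ z ∈ A, s z = k * V.card := by
  induction A using Finset.strongInduction with
  | H A ih =>
    rcases A.eq_empty_or_nonempty with rfl | ⟨z₀, hz₀⟩
    · exact ⟨0, by simp⟩
    · -- the coset `C` of `z₀` lies inside `A`
      set C : Finset (Fin n → Bool) := univ.filter (fun y => bxor z₀ y ∈ V) with hC
      have hCA : C ⊆ A := by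
        intro y hy
        have h := hinv z₀ hz₀ (bxor z₀ y) (mem_filter.1 hy).2
        rwa [bxor_bxor_cancel_left] at h
      have hz₀C : z₀ ∈ C := mem_filter.2 ⟨mem_univ _, by rw [bxor_self]; exact h0⟩
      have hsub : A \ C ⊂ A := sdiff_ssubset hCA ⟨z₀, hz₀C⟩
      -- the remainder is again a union of cosets
      have hinv' : ∀ z ∈ A \ C, ∀ u ∈ V, bxor z u ∈ A \ C := by
        intro z hz u hu
        obtain ⟨hzA, hzC⟩ := mem_sdiff.1 hz
        refine mem_sdiff.2 ⟨hinv z hzA u hu, fun h => hzC ?_⟩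
        have h' : bxor z₀ (bxor z u) ∈ V := (mem_filter.1 h).2
        refine mem_filter.2 ⟨mem_univ _, ?_⟩
        have e : bxor z₀ z = bxor (bxor z₀ (bxor z u)) u := by
          funext i
          simp only [bxor, Bool.xor_assoc, Bool.xor_self, Bool.xor_false]
        rw [e]
        exact hadd _ h' u hu
      obtain ⟨k', hk'⟩ := ih (A \ C) hsub hinv' (fun z hz => hcos z (mem_sdiff.1 hz).1)
      obtain ⟨m, hm⟩ := hcos z₀ hz₀
      refine ⟨k' + m, ?_⟩
      rw [← sum_sdiff hCA, hk', hm]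
      push_cast
      ring

/-! ### Walsh coefficients of a coset-affine function are multiples of `|V|` -/

/-- **Divisibility of the Walsh spectrum by `|V|`.** If `g` is affine on every coset of the subspace `V`
(`0 ∈ V`, `V` closed under `⊕`, all second differences of `g` along `V` vanish), then every unnormalised
Walsh coefficient `W_g(x) = ∑_y (-1)^{g y} (-1)^{y·x}` is an integer multiple of `|V|`: each coset of `V`
contributes `|V|`, `-|V|` or `0`. [cite: Carlet2020, Def. 28 and Prop. 54 (normality; M-subspaces)] -/
theorem W_mem_zmultiples_card_of_affine_on_cosets (g : (Fin n → Bool) → Bool) {V : Finset (Fin n → Bool)}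
    (h0 : zeroVec ∈ V) (hadd : ∀ x ∈ V, ∀ y ∈ V, bxor x y ∈ V)
    (hM : ∀ u ∈ V, ∀ v ∈ V, ∀ y, (g y ^^ g (bxor y u) ^^ g (bxor y v) ^^ g (bxor y (bxor u v))) = false)
    (x : Fin n → Bool) : ∃ k : ℤ, W (fun y => signOf (g y)) x = k * V.card := by
  have hW : W (fun y => signOf (g y)) x =
      ∑ y ∈ (univ : Finset (Fin n → Bool)), signOf (g y) * twist x y := by
    unfold W
    exact sum_congr rfl fun y _ => by rw [twist_comm]
  rw [hW]
  refine exists_int_sum_eq_mul_card_of_invariant h0 hadd (fun y => signOf (g y) * twist x y) univ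
    (fun z _ u _ => mem_univ _) (fun z _ => ?_)
  have h := coset_sum_of_affine_on_cosets hadd g hM z x
  simp only at h
  rcases h with h | h | h
  · exact ⟨1, by rw [h]; simp⟩
  · exact ⟨-1, by rw [h]; simp⟩
  · exact ⟨0, by rw [h]; simp⟩

/-- Pointwise consequence: `|V| · |W_g(x)| ≤ W_g(x)²` (both sides vanish, or `|W_g(x)| ≥ |V|`).
[cite: Carlet2020, Def. 28 and Prop. 54 (normality; M-subspaces)] -/
theorem card_mul_abs_W_le_sq (g : (Fin n → Bool) → Bool) {V : Finset (Fin n → Bool)}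
    (h0 : zeroVec ∈ V) (hadd : ∀ x ∈ V, ∀ y ∈ V, bxor x y ∈ V)
    (hM : ∀ u ∈ V, ∀ v ∈ V, ∀ y, (g y ^^ g (bxor y u) ^^ g (bxor y v) ^^ g (bxor y (bxor u v))) = false)
    (x : Fin n → Bool) :
    (V.card : ℝ) * |W (fun y => signOf (g y)) x| ≤ W (fun y => signOf (g y)) x ^ 2 := by
  have hVpos : (0 : ℝ) < V.card := by exact_mod_cast card_pos.2 ⟨_, h0⟩
  obtain ⟨k, hk⟩ := W_mem_zmultiples_card_of_affine_on_cosets g h0 hadd hM x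
  rw [hk]
  rcases eq_or_ne k 0 with rfl | hne
  · simp
  · have h1 : (1 : ℝ) ≤ |(k : ℝ)| := by exact_mod_cast Int.one_le_abs hne
    rw [abs_mul, abs_of_pos hVpos]
    have e : ((k : ℝ) * V.card) ^ 2 = (|(k : ℝ)| * V.card) * (|(k : ℝ)| * V.card) := by
      rw [← sq, mul_pow, mul_pow, sq_abs]
    rw [e]
    have hle : (V.card : ℝ) ≤ |(k : ℝ)| * V.card := le_mul_of_one_le_left hVpos.le h1
    exact mul_le_mul_of_nonneg_right hle (by positivity)

/-! ### The bound `|Φ| · |V| ≤ √(2ⁿ)` -/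

/-- **Over-structure is off-promise.** If `g` is affine on every coset of the subspace `V` (`0 ∈ V`, `V` closed
under `⊕`, all second differences of `g` along `V` vanish) then `|Φ(f,g)| · |V| ≤ √(2ⁿ)` for every `f`:
`|V| ∑_x |W_g(x)| ≤ ∑_x W_g(x)² = 4ⁿ` (Parseval and `card_mul_abs_W_le_sq`) while
`2ⁿ √(2ⁿ) |Φ(f,g)| = |∑_x (-1)^{f x} W_g(x)| ≤ ∑_x |W_g(x)|`. [folklore] -/
theorem abs_forrelation_mul_card_le_sqrt (f g : (Fin n → Bool) → Bool) {V : Finset (Fin n → Bool)}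
    (h0 : zeroVec ∈ V) (hadd : ∀ x ∈ V, ∀ y ∈ V, bxor x y ∈ V)
    (hM : ∀ u ∈ V, ∀ v ∈ V, ∀ y, (g y ^^ g (bxor y u) ^^ g (bxor y v) ^^ g (bxor y (bxor u v))) = false) :
    |forrelation f g| * V.card ≤ Real.sqrt (2 ^ n) := by
  have hVpos : (0 : ℝ) < V.card := by exact_mod_cast card_pos.2 ⟨_, h0⟩
  -- Parseval: `∑_x W_g(x)² = 4ⁿ`
  have hsumsq : ∑ x, W (fun y => signOf (g y)) x ^ 2 = (2 : ℝ) ^ n * (2 : ℝ) ^ n := by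
    rw [sum_W_sq]
    simp_rw [signOf_sq, sum_const, card_univ, Fintype.card_fun, Fintype.card_bool, Fintype.card_fin,
      nsmul_eq_mul, mul_one]
    push_cast
    ring
  -- `|V| ∑_x |W_g(x)| ≤ 4ⁿ`
  have hsum : (V.card : ℝ) * ∑ x, |W (fun y => signOf (g y)) x| ≤ (2 : ℝ) ^ n * (2 : ℝ) ^ n := by
    rw [← hsumsq, mul_sum]
    exact sum_le_sum fun x _ => card_mul_abs_W_le_sq g h0 hadd hM x
  -- `|S(f,g)| ≤ ∑_x |W_g(x)|`
  have hfs : |fsum (fun x => signOf (f x)) (fun y => signOf (g y))| ≤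
      ∑ x, |W (fun y => signOf (g y)) x| := by
    rw [fsum_eq_sum_mul_W]
    refine (abs_sum_le_sum_abs _ _).trans (le_of_eq (sum_congr rfl fun x _ => ?_))
    have h1 : |signOf (f x)| = 1 := by cases f x <;> simp [signOf]
    rw [abs_mul, h1, one_mul]
  rw [fsum_signOf_eq, sqrt_two_pow_three_mul, abs_mul, abs_of_pos (by positivity)] at hfs
  have hs : Real.sqrt ((2 : ℝ) ^ n) * Real.sqrt ((2 : ℝ) ^ n) = (2 : ℝ) ^ n :=
    Real.mul_self_sqrt (by positivity)
  have key : ((2 : ℝ) ^ n * Real.sqrt ((2 : ℝ) ^ n)) * (|forrelation f g| * V.card) ≤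
      ((2 : ℝ) ^ n * Real.sqrt ((2 : ℝ) ^ n)) * Real.sqrt ((2 : ℝ) ^ n) :=
    calc ((2 : ℝ) ^ n * Real.sqrt ((2 : ℝ) ^ n)) * (|forrelation f g| * V.card)
        = (V.card : ℝ) * ((2 : ℝ) ^ n * Real.sqrt ((2 : ℝ) ^ n) * |forrelation f g|) := by ring
      _ ≤ (V.card : ℝ) * ∑ x, |W (fun y => signOf (g y)) x| := mul_le_mul_of_nonneg_left hfs hVpos.le
      _ ≤ (2 : ℝ) ^ n * (2 : ℝ) ^ n := hsum
      _ = ((2 : ℝ) ^ n * Real.sqrt ((2 : ℝ) ^ n)) * Real.sqrt ((2 : ℝ) ^ n) := by rw [mul_assoc, hs]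
  exact le_of_mul_le_mul_left key (by positivity)

/-- **Large coset-affine structure forces `|Φ| ≤ 1/2`.** If `n` is even, `g` is affine on every coset of the
subspace `V` (`0 ∈ V`, closed under `⊕`, vanishing second differences along `V`) and `|V|² > 2ⁿ`, then
`|Φ(f,g)| ≤ 1/2` for every `f` — in particular `(f,g)` is not a yes-instance of the promise `Φ ≥ 3/5`.
(`|V|` divides `2ⁿ = |V| · |V^⊥|`, so it is a power of two `≥ 2^{n/2+1}`, and `|Φ| · |V| ≤ 2^{n/2}`.)
[cite: AaronsonAmbainis2018, §1.1.1] -/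
theorem abs_forrelation_le_half_of_affine_on_cosets (f g : (Fin n → Bool) → Bool) {V : Finset (Fin n → Bool)}
    (hn : Even n) (h0 : zeroVec ∈ V) (hadd : ∀ x ∈ V, ∀ y ∈ V, bxor x y ∈ V)
    (hM : ∀ u ∈ V, ∀ v ∈ V, ∀ y, (g y ^^ g (bxor y u) ^^ g (bxor y v) ^^ g (bxor y (bxor u v))) = false)
    (hbig : 2 ^ n < V.card ^ 2) : |forrelation f g| ≤ 1 / 2 := by
  obtain ⟨m, rfl⟩ := hn
  -- `|V|` divides `2ⁿ`, hence is a power of two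
  have hdvd : V.card ∣ 2 ^ (m + m) := by
    have h := card_mul_card_perp h0 hadd
    have h' : V.card * (univ.filter fun y => ∀ x ∈ V, twist x y = 1).card = 2 ^ (m + m) := by
      exact_mod_cast h
    exact Dvd.intro _ h'
  obtain ⟨k, _, hk⟩ := (Nat.dvd_prime_pow Nat.prime_two).1 hdvd
  have hmk : m + 1 ≤ k := by
    rw [hk, ← pow_mul] at hbig
    have := (pow_lt_pow_iff_right₀ (by norm_num : (1 : ℕ) < 2)).1 hbig
    omega
  have hVge : (2 : ℝ) ^ (m + 1) ≤ V.card := by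
    rw [hk]
    push_cast
    exact pow_le_pow_right₀ (by norm_num) hmk
  have hsqrt : Real.sqrt ((2 : ℝ) ^ (m + m)) = (2 : ℝ) ^ m := by
    rw [pow_add, Real.sqrt_mul_self (by positivity)]
  have h2 := abs_forrelation_mul_card_le_sqrt f g h0 hadd hM
  rw [hsqrt] at h2
  have h3 : |forrelation f g| * (2 : ℝ) ^ (m + 1) ≤ (2 : ℝ) ^ m :=
    (mul_le_mul_of_nonneg_left hVge (abs_nonneg _)).trans h2
  have hpos : (0 : ℝ) < (2 : ℝ) ^ m := by positivity
  rw [le_div_iff₀ (by norm_num : (0 : ℝ) < 2)]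
  refine le_of_mul_le_mul_right ?_ hpos
  calc |forrelation f g| * 2 * (2 : ℝ) ^ m = |forrelation f g| * (2 : ℝ) ^ (m + 1) := by ring
    _ ≤ (2 : ℝ) ^ m := h3
    _ = 1 * (2 : ℝ) ^ m := (one_mul _).symm

end DerivativeWalsh

end Literature.Computability.QuantumComplexity

end
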